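import Summits.QuantumFields.GaugeBoot.BootstrapLinkCutsAllAxes
import Summits.QuantumFields.GaugeBoot.CubicTorusWave0Classes
import HarnessLib

/-!
# The SITE-reflection cut family along every axis (sound at every coupling) and the complete
# table of the three Kazakov–Zheng reflection families on the even torus (gauge-boot, L3 ↔ L1)

HONEST FRAMING (cell `pub-gaugeboot`, page 1 of every file): the venture produces certified bounds
on lattice expectations at stated coupling, gauge group, dimension and torus size; NOT a mass gap,
NOT a continuum limit, NOT a string tension; NOT Yang–Mills-summit-bearing (barriers
`FixedCouplingUltralocality`, `PerturbativeInvisibility`). Structural; it certifies no number; no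
certificate of the cell sits at `β < 0`. It says which positivity constraints a TORUS bootstrap may
impose; nothing else.

## Content

The first reflection family of the lattice bootstrap (Kazakov–Zheng §3.1) reflects in a lattice
hyperplane `x_k = 0` THROUGH sites. `BootstrapReflectionPositivity` typed its cuts along the time
axis (tree `Θ'`, every real `β`). The cell's L3 lane proved site-hyperplane RP of the torus Wilson
measure on `(ℤ/2Q)^d`, `Q ≥ 2`, along EVERY axis at EVERY real coupling for every compact `G`
(`cubicTorus_siteRP_anyBeta`, Fröhlich–Israel–Lieb–Simon Thm. 2.1). With `rpCuts_sound_iff_suN`: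

* `siteReflectCM k`, `comp_siteReflectCM_mem_polyAlgebra`, `siteReflectCM_siteReflectCM`,
  `measurePreserving_siteReflectCM_wilson`, `halfLinks Q k`, `isHalfObservable_iff_dependsOn`,
  `reflectionPositiveOn_siteReflect_iff`, `siteReflectCM_zero_eq_negReflectCM`, `rpLevelValuesSuN_eq_site`
  (the time-axis instance is `rpLevelValuesSuN` of `BootstrapReflectionPositivity`);
* ★★ `reflectionPositiveOn_siteReflect_suN` / `_uN` — RP for the site family along every axis at
  EVERY real `β`; ★★ `wilson_mem_siteCutLevelValues_suN` — the SITE cuts along every axis keep the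
  Wilson value feasible at every level, every `N`, every real `β`; `siteCut_of_bootstrap_suN` / `_uN`
  — every solution of the untruncated bootstrap satisfies every site cut along every axis;
  ★★ `siteCutGram_nonneg_of_bootstrap_suN` — the site-RP matrices of a solution are PSD;
* THE TABLE of the three families (site `Θ'_k`, link `Θ_k`, diagonal `Θ_{ij}`) for the `SU(N)` word
  SDP on `(ℤ/2Q)^d`, `Q ≥ 2`, `d ≥ 3`:
  ★★★ `threeFamilies_nonneg_suN` — `β ≥ 0`, every `N ≥ 2`: site ✓ (every level), link ✓ (every
  level), diagonal ✗ (eventually infeasible);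
  ★★★ `threeFamilies_suEven` — `SU(2n)`, EVERY real `β`: ✓ ✓ ✗;
  ★★★ `threeFamilies_neg_suOdd` — `N` odd, `3 ≤ N`, `N + 3 ≤ 2d`, every `β < 0`: site ✓, link ✗,
  diagonal ✗; ★★★ `threeFamilies_su3` — `SU(3)`: site ✓ at every `β`, link ✓ iff `0 ≤ β`, diagonal ✗.

What this is NOT: odd tori; `d = 2` (diagonal family sound there, `BootstrapDiagonalReflectionPositivity`);
rates / the level from which infeasibility sets in.

References: J. Fröhlich, R. Israel, E. H. Lieb, B. Simon, Comm. Math. Phys. 62 (1978) 1 Thm. 2.1;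
K. Osterwalder, E. Seiler, Ann. Phys. 110 (1978) 440 §2; V. Kazakov, Z. Zheng, arXiv:2203.11360
§3.1, §4. Folklore-level; not in print as theorems as far as the cell's searches go.
-/

noncomputable section

open MeasureTheory Filter Topology NormedSpace
open scoped ComplexOrder ComplexConjugate
open Literature.MathematicalPhysics.QuantumFieldTheory (LatticeRep Site Edge GaugeConfig wilsonAction wilsonMeasure
  isProbabilityMeasure_wilsonMeasure)
open Literature.MathematicalPhysics.QuantumFieldTheory.WilsonSiteRP (sitePosEdges sharedEdges)

namespace Summit.QuantumFields.GaugeBoot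

open TiltedRP (cubicUnit cubicAxisReflect cubicAxisCoord configReflect siteLinkMap IsHalfObservable IsHalfLink
  isSiteFrame_cubicTorus)

/-! ## The site reflection along the axis `k` as a continuous polynomial-stable involution -/

section Reflection

variable {d L : ℕ} {G : Type*} [Group G] [TopologicalSpace G] [IsTopologicalGroup G]

/-- **The site reflection `Θ'_k` of torus configurations along the axis `k`** (`x_k ↦ -x_k`; the
`k`-links reversed and inverted): the frame theory's `configReflect` at the cubic frame, as a
continuous self-map. [folklore] -/
def siteReflectCM (k : Fin d) : C(GaugeConfig d L G, GaugeConfig d L G) where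
  toFun := configReflect (cubicUnit d L) k (cubicAxisReflect d L k)
  continuous_toFun := by
    refine continuous_pi fun l => ?_
    unfold TiltedRP.configReflect
    split_ifs
    · exact (continuous_apply _).inv
    · exact continuous_apply _

/-- `siteReflectCM k` is `configReflect (cubicUnit d L) k (cubicAxisReflect d L k)`. -/
@[simp] theorem siteReflectCM_apply (k : Fin d) (U : GaugeConfig d L G) :
    siteReflectCM k U = configReflect (cubicUnit d L) k (cubicAxisReflect d L k) U := rfl

/-- **Along the time axis `Θ'_0` is the tree's `GaugeConfig.negReflect`** (`negReflectCM` of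
`BootstrapSymmetryConsequences`; `configReflect_cubicUnit_zero`). -/
theorem siteReflectCM_zero_eq_negReflectCM [NeZero d] :
    (siteReflectCM 0 : C(GaugeConfig d L G, GaugeConfig d L G)) = negReflectCM := by
  ext U e
  rw [siteReflectCM_apply, TiltedRP.configReflect_cubicUnit_zero, negReflectCM_apply]

variable (r : LatticeRep G)

/-- **The polynomial observables are stable under `Θ'_k`.** [folklore] -/
theorem comp_siteReflectCM_mem_polyAlgebra (k : Fin d) {f : C(GaugeConfig d L G, ℝ)}
    (hf : f ∈ polyAlgebra (ι := Edge d L) r) :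
    f.comp (siteReflectCM k) ∈ polyAlgebra (ι := Edge d L) r := by
  have h : polyAlgebra (ι := Edge d L) r ≤ (polyAlgebra (ι := Edge d L) r).comap
      (ContinuousMap.compRightAlgHom ℝ ℝ (siteReflectCM (G := G) (d := d) (L := L) k)) := by
    refine Algebra.adjoin_le ?_
    rintro _ (⟨⟨e, a, b⟩, rfl⟩ | ⟨⟨e, a, b⟩, rfl⟩)
    · change (reEntry r e a b).comp (siteReflectCM k) ∈ polyAlgebra (ι := Edge d L) r
      by_cases he : e.2 = k
      · have : (reEntry r e a b).comp (siteReflectCM (G := G) k) =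
            reEntry r (siteLinkMap (cubicUnit d L) k (cubicAxisReflect d L k) e) b a := by
          ext U
          simp only [ContinuousMap.comp_apply, siteReflectCM_apply, reEntry_apply, TiltedRP.configReflect,
            he, if_true]
          exact (rho_inv_apply_re_im r _ a b).1
        rw [this]
        exact reEntry_mem r _ b a
      · have : (reEntry r e a b).comp (siteReflectCM (G := G) k) =
            reEntry r (siteLinkMap (cubicUnit d L) k (cubicAxisReflect d L k) e) a b := by
          ext U
          simp only [ContinuousMap.comp_apply, siteReflectCM_apply, reEntry_apply, TiltedRP.configReflect,
            he, if_false]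
        rw [this]
        exact reEntry_mem r _ a b
    · change (imEntry r e a b).comp (siteReflectCM k) ∈ polyAlgebra (ι := Edge d L) r
      by_cases he : e.2 = k
      · have : (imEntry r e a b).comp (siteReflectCM (G := G) k) =
            -imEntry r (siteLinkMap (cubicUnit d L) k (cubicAxisReflect d L k) e) b a := by
          ext U
          simp only [ContinuousMap.comp_apply, siteReflectCM_apply, imEntry_apply, TiltedRP.configReflect,
            he, if_true, ContinuousMap.neg_apply]
          exact (rho_inv_apply_re_im r _ a b).2
        rw [this]
        exact Subalgebra.neg_mem _ (imEntry_mem r _ b a)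
      · have : (imEntry r e a b).comp (siteReflectCM (G := G) k) =
            imEntry r (siteLinkMap (cubicUnit d L) k (cubicAxisReflect d L k) e) a b := by
          ext U
          simp only [ContinuousMap.comp_apply, siteReflectCM_apply, imEntry_apply, TiltedRP.configReflect,
            he, if_false]
        rw [this]
        exact imEntry_mem r _ a b
  exact h hf

variable {Q : ℕ}

/-- **`Θ'_k` is an involution** on `(ℤ/2Q)^d`, `Q ≥ 2` (`isSiteFrame_cubicTorus`). -/
theorem siteReflectCM_siteReflectCM (hQ : 2 ≤ Q) (k : Fin d) (U : GaugeConfig d (2 * Q) G) :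
    siteReflectCM k (siteReflectCM k U) = U :=
  (isSiteFrame_cubicTorus d hQ k).configReflect_configReflect U

omit [Group G] [TopologicalSpace G] [IsTopologicalGroup G] in
/-- **The links of the closed half `{0 ≤ x_k ≤ Q}`** of the site reflection along `k` (frame theory's
`IsHalfLink`). [folklore] -/
def halfLinks (Q : ℕ) (k : Fin d) : Set (Edge d (2 * Q)) :=
  {l | IsHalfLink (cubicUnit d (2 * Q)) Q (cubicAxisCoord d (2 * Q) k) l}

omit [Group G] [TopologicalSpace G] [IsTopologicalGroup G] in
/-- `IsHalfObservable` (frame theory) says exactly `DependsOn F (halfLinks Q k)`. -/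
theorem isHalfObservable_iff_dependsOn {α : Type*} (Q : ℕ) (k : Fin d) (F : GaugeConfig d (2 * Q) G → α) :
    IsHalfObservable (cubicUnit d (2 * Q)) Q (cubicAxisCoord d (2 * Q) k) F ↔
      DependsOn F (halfLinks (d := d) Q k) :=
  ⟨fun h _ _ hUV => h _ _ fun l hl => hUV l hl, fun h _ _ hUV => h fun l hl => hUV l hl⟩

omit [Group G] [TopologicalSpace G] [IsTopologicalGroup G] in
/-- Along the time axis the closed half is the tree's `sitePosEdges ∪ sharedEdges`
(`isHalfObservable_cubicUnit_zero_iff` of `CubicTorusWave0Classes`). -/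
theorem halfLinks_zero_dependsOn_iff [NeZero d] [NeZero Q] (hQ : 2 ≤ Q) {α : Type*}
    (F : GaugeConfig d (2 * Q) G → α) :
    DependsOn F (halfLinks (d := d) Q 0) ↔
      DependsOn F ((sitePosEdges ∪ sharedEdges : Finset (Edge d (2 * Q))) : Set (Edge d (2 * Q))) := by
  rw [← isHalfObservable_iff_dependsOn]
  exact TiltedRP.isHalfObservable_cubicUnit_zero_iff hQ F

end Reflection

/-! ## `Θ'_k` preserves the Wilson measure; the packaged site RP statement -/

section Wilson

-- `G : Type` (universe 0) as in the cell's cubic-torus RP files (`CubicTorusRP`).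
variable {d Q N : ℕ} [NeZero Q] {G : Type} [Group G] [TopologicalSpace G] [IsTopologicalGroup G]
  [CompactSpace G] [MeasurableSpace G] [BorelSpace G] [SecondCountableTopology G]
  (ρ : G →* Matrix (Fin N) (Fin N) ℂ)

/-- **`Θ'_k` preserves the torus Wilson measure at every real `β`** (`(ℤ/2Q)^d`, `Q ≥ 2`). -/
theorem measurePreserving_siteReflectCM_wilson (hρ : Continuous ρ) (hQ : 2 ≤ Q) (k : Fin d) (β : ℝ) :
    MeasurePreserving (siteReflectCM k) (wilsonMeasure (d := d) (L := 2 * Q) ρ β)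
      (wilsonMeasure (d := d) (L := 2 * Q) ρ β) := by
  haveI : IsProbabilityMeasure (wilsonMeasure (d := d) (L := 2 * Q) ρ β) :=
    isProbabilityMeasure_wilsonMeasure (ρ := ρ) hρ β
  exact measurePreserving_of_forall_integral_comp_eq (siteReflectCM (G := G) k).continuous.measurable
    fun F hF => TiltedRP.cubicTorus_integral_comp_configReflect ρ hQ k hρ β hF

omit [SecondCountableTopology G] in
/-- **`ReflectionPositiveOn μ_W (Θ'_k) (halfLinks Q k)` is the cell's closed-half SITE RP statement
along `k`** (the shape of `cubicTorus_siteRP_anyBeta`). -/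
theorem reflectionPositiveOn_siteReflect_iff (β : ℝ) (k : Fin d) :
    ReflectionPositiveOn (wilsonMeasure (d := d) (L := 2 * Q) ρ β) (siteReflectCM k) (halfLinks Q k) ↔
      ∀ F : GaugeConfig d (2 * Q) G → ℂ, Measurable F → (∃ C : ℝ, ∀ U, ‖F U‖ ≤ C) →
        IsHalfObservable (cubicUnit d (2 * Q)) Q (cubicAxisCoord d (2 * Q) k) F →
        0 ≤ ∫ U, conj (F (configReflect (cubicUnit d (2 * Q)) k (cubicAxisReflect d (2 * Q) k) U)) *
          F U ∂(wilsonMeasure (d := d) (L := 2 * Q) ρ β) :=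
  ⟨fun h F hF hFb hFo => h F hF hFb ((isHalfObservable_iff_dependsOn Q k F).1 hFo),
    fun h F hF hFb hFS => h F hF hFb ((isHalfObservable_iff_dependsOn Q k F).2 hFS)⟩

end Wilson

/-! ## The site cut family of the `SU(N)` / `U(N)` bootstrap along the axis `k`: sound at every `β` -/

section Unitary

open Literature.MathematicalPhysics.QuantumLattice

variable {d Q : ℕ} [NeZero Q] (N : ℕ) (β : ℝ)

/-- **The level-`n` feasible values of `P` with the SITE cuts along the axis `k`** (`SU(N)` word SDP
on `(ℤ/2Q)^d` with `0 ≤ φ ((v ∘ Θ'_k) · v)` for every level-`n` test function `v` of the closed half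
`{0 ≤ x_k ≤ Q}`). [folklore] -/
def siteCutLevelValuesSuN (k : Fin d) (n : ℕ)
    (P : C(GaugeConfig d (2 * Q) (Matrix.specialUnitaryGroup (Fin N) ℂ), ℝ)) : Set ℝ :=
  rpCutLevelValuesSuN N β (siteReflectCM k) (halfLinks Q k) n P

/-- **The time-axis instance is `rpLevelValuesSuN` of `BootstrapReflectionPositivity`** (`Q ≥ 2`). -/
theorem rpLevelValuesSuN_eq_site [NeZero d] (hQ : 2 ≤ Q) (n : ℕ)
    (P : C(GaugeConfig d (2 * Q) (Matrix.specialUnitaryGroup (Fin N) ℂ), ℝ)) :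
    rpLevelValuesSuN (d := d) (L := 2 * Q) N β n P = siteCutLevelValuesSuN N β 0 n P := by
  ext t
  simp only [rpLevelValuesSuN, siteCutLevelValuesSuN, rpCutLevelValuesSuN, Set.mem_setOf_eq,
    siteReflectCM_zero_eq_negReflectCM, halfLinks_zero_dependsOn_iff hQ]

/-- ★★ **`SU(N)`: the Wilson measure is site-RP along every axis at EVERY real `β`**
(`cubicTorus_siteRP_suN_anyBeta`, in the packaged form). -/
theorem reflectionPositiveOn_siteReflect_suN (hQ : 2 ≤ Q) (k : Fin d) :
    ReflectionPositiveOn (wilsonMeasure (d := d) (L := 2 * Q) (fundamentalRep (Fin N)) β)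
      (siteReflectCM k) (halfLinks Q k) :=
  (reflectionPositiveOn_siteReflect_iff (fundamentalRep (Fin N)) β k).2
    (TiltedRP.cubicTorus_siteRP_suN_anyBeta hQ k β)

/-- ★★ **`U(N)`: the Wilson measure is site-RP along every axis at EVERY real `β`.** -/
theorem reflectionPositiveOn_siteReflect_uN (hQ : 2 ≤ Q) (k : Fin d) :
    ReflectionPositiveOn (wilsonMeasure (d := d) (L := 2 * Q) (unitaryFundamentalRep (Fin N) ℂ) β)
      (siteReflectCM k) (halfLinks Q k) :=
  (reflectionPositiveOn_siteReflect_iff (unitaryFundamentalRep (Fin N) ℂ) β k).2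
    (TiltedRP.cubicTorus_siteRP_uN_anyBeta hQ k β)

/-- ★★ **The SITE cuts along every axis keep the Wilson value feasible at every level** (every `N`,
EVERY real `β`, `(ℤ/2Q)^d`, `Q ≥ 2`). [folklore] -/
theorem wilson_mem_siteCutLevelValues_suN (hQ : 2 ≤ Q) (k : Fin d) (n : ℕ)
    (P : C(GaugeConfig d (2 * Q) (Matrix.specialUnitaryGroup (Fin N) ℂ), ℝ)) :
    ∫ U, P U ∂(wilsonMeasure (fundamentalRep (Fin N)) β) ∈ siteCutLevelValuesSuN N β k n P :=
  wilson_mem_rpCutLevelValues_suN (reflectionPositiveOn_siteReflect_suN N β hQ k) n P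

/-- ★★ **The site cut SDP bounds converge to the Wilson value** (every axis, every real `β`). -/
theorem siteCutLevelValues_subset_Icc_suN (k : Fin d)
    {P : C(GaugeConfig d (2 * Q) (Matrix.specialUnitaryGroup (Fin N) ℂ), ℝ)}
    (hP : P ∈ polyAlgebra (ι := Edge d (2 * Q)) (fundamentalLatticeRep N)) {ε : ℝ} (hε : 0 < ε) :
    ∀ᶠ n in atTop, siteCutLevelValuesSuN N β k n P ⊆
      Set.Icc (∫ U, P U ∂(wilsonMeasure (fundamentalRep (Fin N)) β) - ε)
        (∫ U, P U ∂(wilsonMeasure (fundamentalRep (Fin N)) β) + ε) :=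
  rpCutLevelValues_subset_Icc_suN hP hε

/-- ★★ **Every solution of the untruncated `SU(N)` torus bootstrap satisfies every SITE cut along
every axis, at every real `β`** (axis `0`: `siteRP_of_bootstrap_suN`). [folklore] -/
theorem siteCut_of_bootstrap_suN (hQ : 2 ≤ Q) (k : Fin d)
    {φ : C(GaugeConfig d (2 * Q) (Matrix.specialUnitaryGroup (Fin N) ℂ), ℝ) →ₗ[ℝ] ℝ} (h1 : φ 1 = 1)
    (hpos : ∀ a ∈ polyAlgebra (ι := Edge d (2 * Q)) (fundamentalLatticeRep N), 0 ≤ φ (a * a))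
    (hφ : IsSDFunctional (fundamentalLatticeRep N) (suExp N) (fun _ => wilsonAction (fundamentalRep (Fin N))) β φ)
    {f : C(GaugeConfig d (2 * Q) (Matrix.specialUnitaryGroup (Fin N) ℂ), ℝ)}
    (hf : f ∈ polyAlgebra (ι := Edge d (2 * Q)) (fundamentalLatticeRep N))
    (hfo : IsHalfObservable (cubicUnit d (2 * Q)) Q (cubicAxisCoord d (2 * Q) k) (⇑f)) :
    0 ≤ φ (f.comp (siteReflectCM k) * f) :=
  rpCut_of_bootstrap_suN (reflectionPositiveOn_siteReflect_suN N β hQ k)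
    (fun _ hg => comp_siteReflectCM_mem_polyAlgebra _ k hg) h1 hpos hφ hf
    ((isHalfObservable_iff_dependsOn Q k _).1 hfo)

/-- ★★ **`U(N)`: every solution satisfies every site cut along every axis, at every real `β`.** -/
theorem siteCut_of_bootstrap_uN (hQ : 2 ≤ Q) (k : Fin d)
    {φ : C(GaugeConfig d (2 * Q) (Matrix.unitaryGroup (Fin N) ℂ), ℝ) →ₗ[ℝ] ℝ} (h1 : φ 1 = 1)
    (hpos : ∀ a ∈ polyAlgebra (ι := Edge d (2 * Q)) (unitaryFundamentalLatticeRep N), 0 ≤ φ (a * a))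
    (hφ : IsSDFunctional (unitaryFundamentalLatticeRep N) (uExp N)
      (fun _ => wilsonAction (unitaryFundamentalRep (Fin N) ℂ)) β φ)
    {f : C(GaugeConfig d (2 * Q) (Matrix.unitaryGroup (Fin N) ℂ), ℝ)}
    (hf : f ∈ polyAlgebra (ι := Edge d (2 * Q)) (unitaryFundamentalLatticeRep N))
    (hfo : IsHalfObservable (cubicUnit d (2 * Q)) Q (cubicAxisCoord d (2 * Q) k) (⇑f)) :
    0 ≤ φ (f.comp (siteReflectCM k) * f) :=
  rpCut_of_bootstrap_uN (reflectionPositiveOn_siteReflect_uN N β hQ k)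
    (fun _ hg => comp_siteReflectCM_mem_polyAlgebra _ k hg) h1 hpos hφ hf
    ((isHalfObservable_iff_dependsOn Q k _).1 hfo)

/-- ★★ **The site-RP matrices of a solution are positive semi-definite** (every axis, every real
`β`; real quadratic form on a finite family of half-space polynomial test functions). [folklore] -/
theorem siteCutGram_nonneg_of_bootstrap_suN (hQ : 2 ≤ Q) (k : Fin d) {κ : Type*} [Fintype κ]
    {φ : C(GaugeConfig d (2 * Q) (Matrix.specialUnitaryGroup (Fin N) ℂ), ℝ) →ₗ[ℝ] ℝ} (h1 : φ 1 = 1)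
    (hpos : ∀ a ∈ polyAlgebra (ι := Edge d (2 * Q)) (fundamentalLatticeRep N), 0 ≤ φ (a * a))
    (hφ : IsSDFunctional (fundamentalLatticeRep N) (suExp N) (fun _ => wilsonAction (fundamentalRep (Fin N))) β φ)
    (f : κ → C(GaugeConfig d (2 * Q) (Matrix.specialUnitaryGroup (Fin N) ℂ), ℝ))
    (hf : ∀ j, f j ∈ polyAlgebra (ι := Edge d (2 * Q)) (fundamentalLatticeRep N))
    (hfo : ∀ j, IsHalfObservable (cubicUnit d (2 * Q)) Q (cubicAxisCoord d (2 * Q) k) (⇑(f j))) (c : κ → ℝ) :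
    0 ≤ ∑ i, ∑ j, c i * c j * φ ((f i).comp (siteReflectCM k) * f j) := by
  set g : C(GaugeConfig d (2 * Q) (Matrix.specialUnitaryGroup (Fin N) ℂ), ℝ) := ∑ j, c j • f j with hg
  have hgm : g ∈ polyAlgebra (ι := Edge d (2 * Q)) (fundamentalLatticeRep N) :=
    Subalgebra.sum_mem _ fun j _ => Subalgebra.smul_mem _ (hf j) _
  have hgo : IsHalfObservable (cubicUnit d (2 * Q)) Q (cubicAxisCoord d (2 * Q) k) (⇑g) := by
    intro U V hUV
    simp only [hg, ContinuousMap.coe_sum, ContinuousMap.coe_smul, Finset.sum_apply, Pi.smul_apply]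
    exact Finset.sum_congr rfl fun j _ => by rw [hfo j U V hUV]
  have h := siteCut_of_bootstrap_suN N β hQ k h1 hpos hφ hgm hgo
  have hexp : g.comp (siteReflectCM k) * g = ∑ i, ∑ j, (c i * c j) • ((f i).comp (siteReflectCM k) * f j) := by
    rw [hg, ContinuousMap.ext_iff]
    intro U
    simp only [ContinuousMap.mul_apply, ContinuousMap.comp_apply, ContinuousMap.coe_sum, ContinuousMap.coe_smul,
      Finset.sum_apply, Pi.smul_apply, smul_eq_mul]
    rw [Finset.sum_mul]
    refine Finset.sum_congr rfl fun i _ => ?_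
    rw [Finset.mul_sum]
    refine Finset.sum_congr rfl fun j _ => ?_
    ring
  rw [hexp, map_sum] at h
  simpa only [map_sum, map_smul, smul_eq_mul] using h

/-! ## The table of the three reflection families on the even torus, `d ≥ 3` -/

variable {N}

/-- ★★★ **`β ≥ 0`, every `N ≥ 2`, `d ≥ 3`** (`(ℤ/2Q)^d`, `Q ≥ 2`; axis `k`; mirror `x_i = x_j` with a
third direction `m`): the SITE and LINK cuts keep the Wilson value feasible at every level, the
DIAGONAL cuts (even on gauge-invariant test functions only) are eventually infeasible. [folklore] -/
theorem threeFamilies_nonneg_suN (hN : 2 ≤ N) (hQ : 2 ≤ Q) (hβ : 0 ≤ β) (k : Fin d) {i j m : Fin d}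
    (hij : i ≠ j) (hmi : m ≠ i) (hmj : m ≠ j)
    (P : C(GaugeConfig d (2 * Q) (Matrix.specialUnitaryGroup (Fin N) ℂ), ℝ)) :
    (∀ n, ∫ U, P U ∂(wilsonMeasure (fundamentalRep (Fin N)) β) ∈ siteCutLevelValuesSuN N β k n P) ∧
      (∀ n, ∫ U, P U ∂(wilsonMeasure (fundamentalRep (Fin N)) β) ∈ linkCutLevelValuesSuN N β k n P) ∧
      ∀ᶠ n in atTop, diagRpLevelValuesSuN (d := d) (L := 2 * Q) N β i j n P = ∅ :=
  ⟨fun n => wilson_mem_siteCutLevelValues_suN N β hQ k n P,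
    fun n => wilson_mem_linkCutLevelValues_suN N β hQ k hβ n P,
    diagRpLevelValues_eventually_eq_empty_suN N β hN (even_two_mul Q) hij hmi hmj P⟩

/-- ★★★ **`SU(M)`, `M ≥ 2` even, EVERY real `β`, `d ≥ 3`**: site ✓, link ✓, diagonal ✗. [folklore] -/
theorem threeFamilies_suEven {M : ℕ} (hM : Even M) (h2 : 2 ≤ M) (hQ : 2 ≤ Q) (k : Fin d) {i j m : Fin d}
    (hij : i ≠ j) (hmi : m ≠ i) (hmj : m ≠ j)
    (P : C(GaugeConfig d (2 * Q) (Matrix.specialUnitaryGroup (Fin M) ℂ), ℝ)) :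
    (∀ n, ∫ U, P U ∂(wilsonMeasure (fundamentalRep (Fin M)) β) ∈ siteCutLevelValuesSuN M β k n P) ∧
      (∀ n, ∫ U, P U ∂(wilsonMeasure (fundamentalRep (Fin M)) β) ∈ linkCutLevelValuesSuN M β k n P) ∧
      ∀ᶠ n in atTop, diagRpLevelValuesSuN (d := d) (L := 2 * Q) M β i j n P = ∅ :=
  ⟨fun n => wilson_mem_siteCutLevelValues_suN M β hQ k n P,
    fun n => wilson_mem_linkCutLevelValues_suEven β hM hQ k n P,
    diagRpLevelValues_eventually_eq_empty_suN M β h2 (even_two_mul Q) hij hmi hmj P⟩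

/-- ★★★ **`N` odd, `3 ≤ N`, `N + 3 ≤ 2d`, every `β < 0`**: the SITE cuts keep the Wilson value
feasible at every level while the LINK cuts and the DIAGONAL cuts are eventually infeasible.
[folklore] -/
theorem threeFamilies_neg_suOdd (hN : Odd N) (h3 : 3 ≤ N) (hNd : N + 3 ≤ 2 * d) (hQ : 2 ≤ Q)
    (hβ : β < 0) (k : Fin d) {i j m : Fin d} (hij : i ≠ j) (hmi : m ≠ i) (hmj : m ≠ j)
    (P : C(GaugeConfig d (2 * Q) (Matrix.specialUnitaryGroup (Fin N) ℂ), ℝ)) :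
    (∀ n, ∫ U, P U ∂(wilsonMeasure (fundamentalRep (Fin N)) β) ∈ siteCutLevelValuesSuN N β k n P) ∧
      (∀ᶠ n in atTop, linkCutLevelValuesSuN N β k n P = ∅) ∧
      ∀ᶠ n in atTop, diagRpLevelValuesSuN (d := d) (L := 2 * Q) N β i j n P = ∅ :=
  ⟨fun n => wilson_mem_siteCutLevelValues_suN N β hQ k n P,
    linkCutLevelValues_eventually_eq_empty_suOdd β hQ k hN h3 hNd hβ P,
    diagRpLevelValues_eventually_eq_empty_suN N β (by omega) (even_two_mul Q) hij hmi hmj P⟩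

/-- ★★★ **`SU(3)` on `(ℤ/2Q)^d`, `d ≥ 3`, `Q ≥ 2`, every real `β`**: the SITE cuts are sound at every
level; the LINK cuts are sound at every level for every observable IFF `0 ≤ β`; the DIAGONAL cuts
are eventually infeasible. [folklore] -/
theorem threeFamilies_su3 (hQ : 2 ≤ Q) (hd : 3 ≤ d) (k : Fin d) {i j m : Fin d} (hij : i ≠ j)
    (hmi : m ≠ i) (hmj : m ≠ j) :
    (∀ (n : ℕ) (P : C(GaugeConfig d (2 * Q) (Matrix.specialUnitaryGroup (Fin 3) ℂ), ℝ)),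
        ∫ U, P U ∂(wilsonMeasure (fundamentalRep (Fin 3)) β) ∈ siteCutLevelValuesSuN 3 β k n P) ∧
      ((∀ (n : ℕ) (P : C(GaugeConfig d (2 * Q) (Matrix.specialUnitaryGroup (Fin 3) ℂ), ℝ)),
          ∫ U, P U ∂(wilsonMeasure (fundamentalRep (Fin 3)) β) ∈ linkCutLevelValuesSuN 3 β k n P) ↔ 0 ≤ β) ∧
      ∀ P : C(GaugeConfig d (2 * Q) (Matrix.specialUnitaryGroup (Fin 3) ℂ), ℝ),
        ∀ᶠ n in atTop, diagRpLevelValuesSuN (d := d) (L := 2 * Q) 3 β i j n P = ∅ :=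
  ⟨fun n P => wilson_mem_siteCutLevelValues_suN 3 β hQ k n P, linkCuts_sound_iff_su3 β hQ k hd,
    fun P => diagRpLevelValues_eventually_eq_empty_suN 3 β (by norm_num) (even_two_mul Q) hij hmi hmj P⟩

end Unitary

end Summit.QuantumFields.GaugeBoot

end
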